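import Mathlib
import Summits.MatrixMultiplication.MatrixMultiplication.Theorems.SubgroupIdentityDesigns.Negative.TransitiveTorus
import Summits.MatrixMultiplication.MatrixMultiplication.Theorems.SubgroupIdentityDesigns.Negative.OrbitPairRight

/-!
# Unimodular subgroups of order `p² - 1` act regularly (all `p`)

Route `LevelGradedCohnUmans`, crux `SubgroupIdentityDesigns`, the `(m,k) = (2,1)` cell, `p`-free
case.  The cross-member engine `TransitiveTorus` / `OrbitPairRight` needs a subgroup `K` of one
member acting FREELY and TRANSITIVELY on `𝔽_p² ∖ 0`.  Two generic supplies of such `K`: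
* `eq_one_of_det_one_of_fix`: a unimodular element of `p'`-order fixing a non-zero vector is the
  identity (it is unipotent: `(k-1)² = 0`, so `k^N = 1 + N(k-1)`); hence every subgroup of
  `SL₂(𝔽_p)` of order prime to `p` acts freely (`free_of_det_one`);
* `transitive_of_free_of_card`: a freely acting subgroup of order `p² - 1` is transitive
  (counting).
So a member containing a subgroup `K ≤ SL₂(𝔽_p)` with `|K| = p² - 1`, another member having an
element outside `K`, carries no level-one identity design:
`no_levelOne_design_of_unimodular₂₁/₃₁/₃₂/₁₂/₁₃/₂₃`.  This is uniform in `p` and covers at once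
the three binary polyhedral regular groups `2T = SL(2,3) ≤ GL₂(𝔽₅)`, `2O ≤ GL₂(𝔽₇)`,
`2I = SL(2,5) ≤ GL₂(𝔽₁₁)` (the multiplicative groups of the exceptional near-fields of orders
`5², 7², 11²` inside `SL₂`).  No TPP, no volume hypothesis.
VALUE = THEOREM, NOT summit progress; the crux item stmt-MatrixMultiplication-14079 is untouched
and remains open.
-/

set_option linter.dupNamespace false

noncomputable section

open scoped BigOperators Classical

open Summit.MatrixMultiplication.MatrixMultiplication.Theorems.LieRankDesigns.Negative (GLm Mat)

namespace Summit.MatrixMultiplication.MatrixMultiplication.Theorems.SubgroupIdentityDesigns.Negative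

section RegularSL

variable {p : ℕ} [hp : Fact p.Prime]

/-- Freeness from the triviality of stabilisers. -/
theorem free_of_fixers {K : Subgroup (GLm p 2)}
    (hfix : ∀ a : Fin 2 → ZMod p, a ≠ 0 → ∀ g ∈ K, ((g : GLm p 2) : Mat p 2).mulVec a = a → g = 1) :
    ∀ a : Fin 2 → ZMod p, a ≠ 0 → ∀ k ∈ K, ∀ k' ∈ K,
      ((k : GLm p 2) : Mat p 2).mulVec a = ((k' : GLm p 2) : Mat p 2).mulVec a → k = k' := by
  intro a ha k hk k' hk' e
  have hg : ((k'⁻¹ * k : GLm p 2) : Mat p 2).mulVec a = a := by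
    rw [Units.val_mul, ← Matrix.mulVec_mulVec, e, Matrix.mulVec_mulVec, ← Units.val_mul,
      inv_mul_cancel, Units.val_one, Matrix.one_mulVec]
  have h1 := hfix a ha (k'⁻¹ * k) (K.mul_mem (K.inv_mem hk') hk) hg
  exact (inv_mul_eq_one.mp h1).symm

/-- **A unimodular element of `p'`-order fixing a non-zero vector is the identity.** -/
theorem eq_one_of_det_one_of_fix (k : GLm p 2) (hdet : Matrix.det (k : Mat p 2) = 1) {N : ℕ}
    (hN : ¬ p ∣ N) (hkN : k ^ N = 1) {a : Fin 2 → ZMod p} (ha : a ≠ 0)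
    (hka : (k : Mat p 2).mulVec a = a) : k = 1 := by
  set A : Mat p 2 := (k : Mat p 2) with hA
  have e0 := congr_fun hka 0
  have e1 := congr_fun hka 1
  rw [mulVec_two_apply_zero] at e0
  rw [mulVec_two_apply_one] at e1
  rw [Matrix.det_fin_two] at hdet
  -- the fixed vector forces `det (A - 1) = 0`, i.e. `tr A = 2`
  have hD0 : ((A 0 0 - 1) * (A 1 1 - 1) - A 0 1 * A 1 0) * a 0 = 0 := by
    linear_combination (A 1 1 - 1) * e0 - A 0 1 * e1
  have hD1 : ((A 0 0 - 1) * (A 1 1 - 1) - A 0 1 * A 1 0) * a 1 = 0 := by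
    linear_combination (A 0 0 - 1) * e1 - A 1 0 * e0
  have hD : (A 0 0 - 1) * (A 1 1 - 1) - A 0 1 * A 1 0 = 0 := by
    by_contra hD
    apply ha
    funext i
    fin_cases i
    · simpa [hD] using hD0
    · simpa [hD] using hD1
  have htr : A 0 0 + A 1 1 = 2 := by linear_combination hdet - hD
  -- `A - 1` squares to zero
  have hM2 : (A - 1) * (A - 1) = 0 := by
    ext i j
    fin_cases i <;> fin_cases j <;>
      simp only [Matrix.mul_apply, Fin.sum_univ_two, Matrix.sub_apply, Matrix.one_apply_eq,
        Matrix.one_apply_ne (show (0 : Fin 2) ≠ 1 by decide),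
        Matrix.one_apply_ne (show (1 : Fin 2) ≠ 0 by decide), Matrix.zero_apply, Fin.zero_eta,
        Fin.mk_one, Fin.isValue, sub_zero]
    · linear_combination (A 0 0 - 1) * htr - hD
    · linear_combination A 0 1 * htr
    · linear_combination A 1 0 * htr
    · linear_combination (A 1 1 - 1) * htr - hD
  -- hence `A ^ m = 1 + m • (A - 1)`
  have hpow : ∀ m : ℕ, A ^ m = 1 + (m : ZMod p) • (A - 1) := by
    intro m
    induction m with
    | zero => simp
    | succ m ih =>
      have hMA : (A - 1) * A = A - 1 := by
        calc (A - 1) * A = (A - 1) * (A - 1) + (A - 1) := by noncomm_ring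
          _ = A - 1 := by rw [hM2, zero_add]
      rw [pow_succ, ih, add_mul, one_mul, smul_mul_assoc, hMA, Nat.cast_succ, add_smul, one_smul]
      abel
  have hAN : A ^ N = 1 := by rw [hA, ← Units.val_pow_eq_pow_val, hkN, Units.val_one]
  have h0 : (N : ZMod p) • (A - 1) = 0 := by
    have h := hpow N
    rw [hAN] at h
    exact (add_eq_left.mp h.symm)
  rcases smul_eq_zero.mp h0 with hN0 | hA1
  · exact absurd ((ZMod.natCast_eq_zero_iff N p).mp hN0) hN
  · exact Units.val_eq_one.mp (sub_eq_zero.mp hA1)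

/-- **Subgroups of `SL₂(𝔽_p)` of order prime to `p` act freely on non-zero vectors.** -/
theorem free_of_det_one {K : Subgroup (GLm p 2)}
    (hKdet : ∀ k ∈ K, Matrix.det ((k : GLm p 2) : Mat p 2) = 1) (hKp : ¬ p ∣ Nat.card K) :
    ∀ a : Fin 2 → ZMod p, a ≠ 0 → ∀ k ∈ K, ∀ k' ∈ K,
      ((k : GLm p 2) : Mat p 2).mulVec a = ((k' : GLm p 2) : Mat p 2).mulVec a → k = k' := by
  refine free_of_fixers fun a ha g hg hga => ?_
  have hgN : g ^ Nat.card K = 1 := by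
    have h := pow_card_eq_one' (G := K) (x := ⟨g, hg⟩)
    exact congrArg Subtype.val h
  exact eq_one_of_det_one_of_fix g (hKdet g hg) hKp hgN ha hga

/-- **A freely acting subgroup of order `p² - 1` is transitive on non-zero vectors.** -/
theorem transitive_of_free_of_card {K : Subgroup (GLm p 2)}
    (hfree : ∀ a : Fin 2 → ZMod p, a ≠ 0 → ∀ k ∈ K, ∀ k' ∈ K,
      ((k : GLm p 2) : Mat p 2).mulVec a = ((k' : GLm p 2) : Mat p 2).mulVec a → k = k')
    (hcard : Nat.card K = p ^ 2 - 1) :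
    ∀ a : Fin 2 → ZMod p, a ≠ 0 → ∀ v : Fin 2 → ZMod p, v ≠ 0 → ∃ k ∈ K,
      ((k : GLm p 2) : Mat p 2).mulVec a = v := by
  intro a ha v hv
  haveI : Fintype K := Fintype.ofFinite K
  set S : Finset (Fin 2 → ZMod p) := Finset.univ.filter (· ≠ 0) with hS
  set T : Finset (Fin 2 → ZMod p) :=
    (Finset.univ : Finset K).image (fun k : K => ((k.1 : GLm p 2) : Mat p 2).mulVec a) with hT
  have hScard : S.card = p ^ 2 - 1 := by
    rw [hS, Finset.filter_ne' Finset.univ (0 : Fin 2 → ZMod p), Finset.card_erase_of_mem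
      (Finset.mem_univ _), Finset.card_univ, Fintype.card_fun, ZMod.card, Fintype.card_fin]
  have hTS : T ⊆ S := by
    intro w hw
    rw [hT, Finset.mem_image] at hw
    obtain ⟨k, -, rfl⟩ := hw
    rw [hS, Finset.mem_filter]
    refine ⟨Finset.mem_univ _, fun h0 => ha ?_⟩
    have := congrArg (((k.1 : GLm p 2)⁻¹ : GLm p 2) : Mat p 2).mulVec h0
    rwa [Matrix.mulVec_mulVec, ← Units.val_mul, inv_mul_cancel, Units.val_one, Matrix.one_mulVec,
      Matrix.mulVec_zero] at this
  have hTcard : T.card = p ^ 2 - 1 := by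
    rw [hT, Finset.card_image_of_injective _ ?_, Finset.card_univ, ← Nat.card_eq_fintype_card,
      hcard]
    intro k k' e
    exact Subtype.ext (hfree a ha k k.2 k' k'.2 e)
  have hST : S ⊆ T := (Finset.eq_of_subset_of_card_le hTS (by rw [hScard, hTcard])).symm.subset
  have hvT : v ∈ T := hST (by rw [hS, Finset.mem_filter]; exact ⟨Finset.mem_univ _, hv⟩)
  rw [hT, Finset.mem_image] at hvT
  obtain ⟨k, -, hk⟩ := hvT
  exact ⟨k, k.2, hk⟩

/-- `p ∤ p² - 1`. -/
theorem not_dvd_sq_sub_one : ¬ p ∣ p ^ 2 - 1 := by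
  intro h
  have hp2 := hp.out.two_le
  have h1 : p ∣ p ^ 2 := dvd_pow_self p two_ne_zero
  have hle : 1 ≤ p ^ 2 := Nat.one_le_pow _ _ (by omega)
  have : p ∣ p ^ 2 - (p ^ 2 - 1) := Nat.dvd_sub h1 h
  rw [Nat.sub_sub_self hle] at this
  exact hp.out.one_lt.ne' (Nat.dvd_one.mp this)


/-! ### The six placements -/

/-- **A subgroup of `SL₂(𝔽_p)` of order `p² - 1` in `H₂`, an element of `H₁` outside it ⇒ no
level-one identity design** (all `p`; no TPP). -/
theorem no_levelOne_design_of_unimodular₂₁ {H₁ H₂ H₃ : Subgroup (GLm p 2)} (K : Subgroup (GLm p 2))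
    (hKdet : ∀ k ∈ K, Matrix.det ((k : GLm p 2) : Mat p 2) = 1) (hKcard : Nat.card K = p ^ 2 - 1)
    (hKH : K ≤ H₂) (k₀ : GLm p 2) (hk₀ : k₀ ∈ H₁) (hk₀K : k₀ ∉ K) :
    ¬ ∃ c : Mat p 2 → ℂ, (∀ M, 1 < M.rank → c M = 0) ∧
      (∑ M, c M * ZMod.stdAddChar (Matrix.trace (M * ((1 : GLm p 2) : Mat p 2)))) = 1 ∧
      ∀ a ∈ H₁, ∀ b ∈ H₂, ∀ g ∈ H₃, a * b * g ≠ 1 →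
        (∑ M, c M *
          ZMod.stdAddChar (Matrix.trace (M * ((a * b * g : GLm p 2) : Mat p 2)))) = 0 :=
  no_levelOne_design_of_transitive₂₁ K hKH k₀ hk₀ hk₀K
    (free_of_det_one hKdet (hKcard ▸ not_dvd_sq_sub_one))
    (transitive_of_free_of_card (free_of_det_one hKdet (hKcard ▸ not_dvd_sq_sub_one)) hKcard)

/-- **A subgroup of `SL₂(𝔽_p)` of order `p² - 1` in `H₃`, an element of `H₁` outside it ⇒ no
level-one identity design** (all `p`; no TPP). -/
theorem no_levelOne_design_of_unimodular₃₁ {H₁ H₂ H₃ : Subgroup (GLm p 2)} (K : Subgroup (GLm p 2))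
    (hKdet : ∀ k ∈ K, Matrix.det ((k : GLm p 2) : Mat p 2) = 1) (hKcard : Nat.card K = p ^ 2 - 1)
    (hKH : K ≤ H₃) (k₀ : GLm p 2) (hk₀ : k₀ ∈ H₁) (hk₀K : k₀ ∉ K) :
    ¬ ∃ c : Mat p 2 → ℂ, (∀ M, 1 < M.rank → c M = 0) ∧
      (∑ M, c M * ZMod.stdAddChar (Matrix.trace (M * ((1 : GLm p 2) : Mat p 2)))) = 1 ∧
      ∀ a ∈ H₁, ∀ b ∈ H₂, ∀ g ∈ H₃, a * b * g ≠ 1 →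
        (∑ M, c M *
          ZMod.stdAddChar (Matrix.trace (M * ((a * b * g : GLm p 2) : Mat p 2)))) = 0 :=
  no_levelOne_design_of_transitive₃₁ K hKH k₀ hk₀ hk₀K
    (free_of_det_one hKdet (hKcard ▸ not_dvd_sq_sub_one))
    (transitive_of_free_of_card (free_of_det_one hKdet (hKcard ▸ not_dvd_sq_sub_one)) hKcard)

/-- **A subgroup of `SL₂(𝔽_p)` of order `p² - 1` in `H₃`, an element of `H₂` outside it ⇒ no
level-one identity design** (all `p`; no TPP). -/
theorem no_levelOne_design_of_unimodular₃₂ {H₁ H₂ H₃ : Subgroup (GLm p 2)} (K : Subgroup (GLm p 2))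
    (hKdet : ∀ k ∈ K, Matrix.det ((k : GLm p 2) : Mat p 2) = 1) (hKcard : Nat.card K = p ^ 2 - 1)
    (hKH : K ≤ H₃) (k₀ : GLm p 2) (hk₀ : k₀ ∈ H₂) (hk₀K : k₀ ∉ K) :
    ¬ ∃ c : Mat p 2 → ℂ, (∀ M, 1 < M.rank → c M = 0) ∧
      (∑ M, c M * ZMod.stdAddChar (Matrix.trace (M * ((1 : GLm p 2) : Mat p 2)))) = 1 ∧
      ∀ a ∈ H₁, ∀ b ∈ H₂, ∀ g ∈ H₃, a * b * g ≠ 1 →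
        (∑ M, c M *
          ZMod.stdAddChar (Matrix.trace (M * ((a * b * g : GLm p 2) : Mat p 2)))) = 0 :=
  no_levelOne_design_of_transitive₃₂ K hKH k₀ hk₀ hk₀K
    (free_of_det_one hKdet (hKcard ▸ not_dvd_sq_sub_one))
    (transitive_of_free_of_card (free_of_det_one hKdet (hKcard ▸ not_dvd_sq_sub_one)) hKcard)

/-- **A subgroup of `SL₂(𝔽_p)` of order `p² - 1` in `H₁`, an element of `H₂` outside it ⇒ no
level-one identity design** (all `p`; no TPP). -/
theorem no_levelOne_design_of_unimodular₁₂ {H₁ H₂ H₃ : Subgroup (GLm p 2)} (K : Subgroup (GLm p 2))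
    (hKdet : ∀ k ∈ K, Matrix.det ((k : GLm p 2) : Mat p 2) = 1) (hKcard : Nat.card K = p ^ 2 - 1)
    (hKH : K ≤ H₁) (k₀ : GLm p 2) (hk₀ : k₀ ∈ H₂) (hk₀K : k₀ ∉ K) :
    ¬ ∃ c : Mat p 2 → ℂ, (∀ M, 1 < M.rank → c M = 0) ∧
      (∑ M, c M * ZMod.stdAddChar (Matrix.trace (M * ((1 : GLm p 2) : Mat p 2)))) = 1 ∧
      ∀ a ∈ H₁, ∀ b ∈ H₂, ∀ g ∈ H₃, a * b * g ≠ 1 →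
        (∑ M, c M *
          ZMod.stdAddChar (Matrix.trace (M * ((a * b * g : GLm p 2) : Mat p 2)))) = 0 :=
  no_levelOne_design_of_transitive₁₂ K hKH k₀ hk₀ hk₀K
    (free_of_det_one hKdet (hKcard ▸ not_dvd_sq_sub_one))
    (transitive_of_free_of_card (free_of_det_one hKdet (hKcard ▸ not_dvd_sq_sub_one)) hKcard)

/-- **A subgroup of `SL₂(𝔽_p)` of order `p² - 1` in `H₁`, an element of `H₃` outside it ⇒ no
level-one identity design** (all `p`; no TPP). -/
theorem no_levelOne_design_of_unimodular₁₃ {H₁ H₂ H₃ : Subgroup (GLm p 2)} (K : Subgroup (GLm p 2))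
    (hKdet : ∀ k ∈ K, Matrix.det ((k : GLm p 2) : Mat p 2) = 1) (hKcard : Nat.card K = p ^ 2 - 1)
    (hKH : K ≤ H₁) (k₀ : GLm p 2) (hk₀ : k₀ ∈ H₃) (hk₀K : k₀ ∉ K) :
    ¬ ∃ c : Mat p 2 → ℂ, (∀ M, 1 < M.rank → c M = 0) ∧
      (∑ M, c M * ZMod.stdAddChar (Matrix.trace (M * ((1 : GLm p 2) : Mat p 2)))) = 1 ∧
      ∀ a ∈ H₁, ∀ b ∈ H₂, ∀ g ∈ H₃, a * b * g ≠ 1 →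
        (∑ M, c M *
          ZMod.stdAddChar (Matrix.trace (M * ((a * b * g : GLm p 2) : Mat p 2)))) = 0 :=
  no_levelOne_design_of_transitive₁₃ K hKH k₀ hk₀ hk₀K
    (free_of_det_one hKdet (hKcard ▸ not_dvd_sq_sub_one))
    (transitive_of_free_of_card (free_of_det_one hKdet (hKcard ▸ not_dvd_sq_sub_one)) hKcard)

/-- **A subgroup of `SL₂(𝔽_p)` of order `p² - 1` in `H₂`, an element of `H₃` outside it ⇒ no
level-one identity design** (all `p`; no TPP). -/
theorem no_levelOne_design_of_unimodular₂₃ {H₁ H₂ H₃ : Subgroup (GLm p 2)} (K : Subgroup (GLm p 2))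
    (hKdet : ∀ k ∈ K, Matrix.det ((k : GLm p 2) : Mat p 2) = 1) (hKcard : Nat.card K = p ^ 2 - 1)
    (hKH : K ≤ H₂) (k₀ : GLm p 2) (hk₀ : k₀ ∈ H₃) (hk₀K : k₀ ∉ K) :
    ¬ ∃ c : Mat p 2 → ℂ, (∀ M, 1 < M.rank → c M = 0) ∧
      (∑ M, c M * ZMod.stdAddChar (Matrix.trace (M * ((1 : GLm p 2) : Mat p 2)))) = 1 ∧
      ∀ a ∈ H₁, ∀ b ∈ H₂, ∀ g ∈ H₃, a * b * g ≠ 1 →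
        (∑ M, c M *
          ZMod.stdAddChar (Matrix.trace (M * ((a * b * g : GLm p 2) : Mat p 2)))) = 0 :=
  no_levelOne_design_of_transitive₂₃ K hKH k₀ hk₀ hk₀K
    (free_of_det_one hKdet (hKcard ▸ not_dvd_sq_sub_one))
    (transitive_of_free_of_card (free_of_det_one hKdet (hKcard ▸ not_dvd_sq_sub_one)) hKcard)

end RegularSL

end Summit.MatrixMultiplication.MatrixMultiplication.Theorems.SubgroupIdentityDesigns.Negative

end
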